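import Summits.QuantumFields.YangMills.Theorems.BalabanUVNodesN15KingModelBoxSumRulesResolvent
import Summits.QuantumFields.YangMills.Theorems.BalabanUVNodesN15KingModelBoxShiftedHalfGrids
import HarnessLib

/-!
# BalabanUVNodes ∕ N15 — THE KING-MODEL RUNG (PART Ϟ-y): THE INFRARED REGIME `m² → 0⁺` AT FIXED `c > 0` IN FINITE VOLUME — THE ZERO MODE: `G_T(x,y) = 1∕(|T|m²) + R_T(x,y;m²)` with
# `|R_T| ≤ |T|⁻¹Σ_{q≠0}(c·lapSym₀(q))⁻¹` uniformly in `m²`, so `m²·G_T(x,y) → |T|⁻¹`; on the box the Neumann zero mode gives `G^Ω(s,t) = 1∕(|Ω|m²) + R^Ω` and `m²·G^Ω(s,t) → |Ω|⁻¹`; the free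
# energy densities are `|T|⁻¹ln m² + (regular)` (Track A, DAG node N15 = NE2; FAN-OUT v1.1 §N15 s3 «KING-MODEL RUNG»; King (2.17) p.653, (3.89) p.668, (4.4)∕(4.35) pp.670∕674; count-neutral)

HONEST FRAMING.  Count-neutral (cell `pub-ymgap`, seat `pub-ymgap-dag-n15-e` g41; K3ᴬ key **stmt-QuantumFields-27247** `--supports … --as helper` per KEY MAP v3).  TEMPLATE LITERATURE:
C. King, Commun. Math. Phys. **102** (1986) 649–677 [King1986]: (2.13)∕(2.17) p.653, (3.89) p.668, (4.4) p.670 (`lapSym(q) = m² + cΣ_μ(2−2cos p′_μ)`), (4.35) p.674 (plane waves), §4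
p.670 l.8–13 (King's region `Ω`).  Companion of part Ϟ-x (the ultraviolet∕large-mass regime `m² → ∞`): here `m² → 0⁺` at fixed `c > 0` and fixed finite volume, where the constant mode
`q = 0` (torus) ∕ `k = 0` (the Neumann zero mode of the box) carries the whole `1∕m²` divergence.  THIS FILE: §1 `cos_sOf_lt_one_of_ne_zero`, ★ `lapSym_massless_pos` (`q ≠ 0 ⇒ lapSym K c 0 q
> 0` for `c > 0`), `lapSym_massless_zero`; §2 TORUS ★★ **`lapF_inv_eq_zeroMode_add`** (`G_T(x,y) = 1∕(|T|m²) + |T|⁻¹Σ_{q≠0}lapSym(q)⁻¹Re e^{iq·(x−y)}`), ★★ `abs_lapF_inv_sub_zeroMode_le` (the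
regular part is bounded by `|T|⁻¹Σ_{q≠0}(lapSym K c 0 q)⁻¹`, uniformly in `m² > 0`), ★★★ **`tendsto_mass_mul_lapF_inv_nhdsGT_zero`** (`m²·G_T(x,y) → |T|⁻¹` as `m² → 0⁺`), ★★
**`log_det_lapF_eq_zeroMode_add`** (`ln det = ln m² + Σ_{q≠0}ln lapSym(q)`), ★★ `tendsto_log_det_lapF_sub_log` (`ln det(c(−Δ)+m²) − ln m² → Σ_{q≠0}ln(c·lapSym₀(q))`); §3 BOX `boxWaveWeight_zero`
(`= |Ω|`), ★ `lapSym_dblBox_massless_pos`, ★★ **`kingBoxGreen_eq_zeroMode_add`** (`G^Ω(s,t) = 1∕(|Ω|m²) + Σ_{k≠0}w_k(s)w_k(t)∕(lapSym(2n)(k̂)·weight_k)`), ★★★ **`tendsto_mass_mul_kingBoxGreen_nhdsGT_zero`**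
(`m²·G^Ω(s,t) → |Ω|⁻¹`), ★★ `log_det_boxOp_eq_zeroMode_add`, ★★ `tendsto_log_det_boxOp_sub_log`.

PRIOR TREE ART (named, USED not restated): Ε-e (`lapF_inv_apply_eq_fourier`), Ε-k (`log_det_lapF`), Ϟ-c (`kingBoxGreen_eq_sum_boxWave`, `log_det_boxOp`), Ϟ-a (`boxWave`, `boxWaveWeight`,
`boxWaveWeight_pos`), Ϟ-e (`card_kingBox`), Ϟ-s (`lapSym_eq_add_mass`, `lapSym_zero_momentum`, `boxWave_zero`, `dblBox_zero`), Ν (`dblBox_injective`), `King1986` (`lapF`, `lapSym`, `lapSym_ge`),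
`B5Prop11Plancherel` (`Tor`, `chi`, `chi_zero_left`, `sOf`, `sOf_ne_zero`, `abs_sOf_le`), Mathlib (`Real.cos_eq_one_iff_of_lt_of_lt`, `tendsto_finsetSum`, `nhdsWithin`).  NOT Bałaban's
covariant objects; NOT a node discharge (N15 is booked through n15-a's knit, untouched); nothing continuum-YM ∕ `ℝ⁴` ∕ OS ∕ Clay.  0 `sorry`; 0 `def`.

HONEST SCOPE.  King's `A = 0` free operators in FINITE volume (torus `Πℤ∕K_μ`, box `Π{0,…,n_μ−1}`), `c > 0` fixed, `m² → 0⁺` (`Filter.nhdsWithin 0 (Set.Ioi 0)`); nothing is claimed about the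
infinite-volume kernel in the infrared.  Locators: [King1986] (2.13)∕(2.17) p.653, (3.89) p.668, (4.4) p.670, (4.35) p.674, §4 p.670 l.8–13.
-/

noncomputable section

open scoped BigOperators Topology
open Finset Filter

namespace Summit.QuantumFields.YangMills.BalabanUVNodes.N15KingModelRung.TorusSpectral

open Literature.MathematicalPhysics.QuantumFieldTheory.Balaban1983to89.B5Prop11Plancherel (Tor chi chi_zero_left sOf sOf_ne_zero abs_sOf_le)
open Literature.MathematicalPhysics.QuantumFieldTheory.King1986.Torus

variable {d : ℕ}

/-! ## §1 The massless symbol vanishes only at the zero momentum -/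

section Symbol

variable (K : Fin (d + 1) → ℕ) [hK : ∀ i, NeZero (K i)]

/-- for `q ≠ 0` some reduced momentum `p′_ν(q) ∈ [−π,π]∖{0}` has `cos p′_ν < 1`. [cite: King1986, (4.4) p.670] -/
theorem cos_sOf_lt_one_of_ne_zero {q : Tor K} (hq : q ≠ 0) : ∃ ν, Real.cos (sOf K q ν) < 1 := by
  obtain ⟨ν, hν⟩ := Function.ne_iff.mp (sOf_ne_zero K hq)
  refine ⟨ν, lt_of_le_of_ne (Real.cos_le_one _) fun h => hν ?_⟩
  have hb := abs_le.mp (abs_sOf_le K q ν)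
  exact (Real.cos_eq_one_iff_of_lt_of_lt (by linarith [Real.pi_pos]) (by linarith [Real.pi_pos])).mp h

/-- ★ **THE MASSLESS SYMBOL IS POSITIVE OFF THE ZERO MOMENTUM**: `c > 0`, `q ≠ 0 ⇒ lapSym K c 0 q > 0`. [cite: King1986, (4.4) p.670] -/
theorem lapSym_massless_pos {c : ℝ} (hc : 0 < c) {q : Tor K} (hq : q ≠ 0) : 0 < lapSym K c 0 q := by
  obtain ⟨ν, hν⟩ := cos_sOf_lt_one_of_ne_zero K hq
  unfold lapSym
  rw [zero_add]
  refine mul_pos hc (lt_of_lt_of_le (by linarith) (Finset.single_le_sum (fun μ _ => by linarith [Real.cos_le_one (sOf K q μ)]) (Finset.mem_univ ν)))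

omit hK in
/-- the massless symbol vanishes at the zero momentum. [cite: King1986, (4.4) p.670] -/
theorem lapSym_massless_zero (c : ℝ) : lapSym K c 0 0 = 0 := lapSym_zero_momentum K c 0

end Symbol

/-! ## §2 The torus: the zero mode -/

section Torus

variable (K : Fin (d + 1) → ℕ) [hK : ∀ i, NeZero (K i)] {c : ℝ}

/-- ★★ **THE ZERO-MODE DECOMPOSITION OF THE TORUS COVARIANCE**: `G_T(x,y) = 1∕(|T|m²) + |T|⁻¹Σ_{q≠0} lapSym(q)⁻¹Re e^{iq·(x−y)}` (`c ≥ 0`, `m² > 0`). [cite: King1986, (2.17) p.653, (4.35) p.674] -/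
theorem lapF_inv_eq_zeroMode_add (hc : 0 ≤ c) {m2 : ℝ} (hm : 0 < m2) (x y : Tor K) :
    (lapF K c m2)⁻¹ x y = ((Fintype.card (Tor K) : ℝ) * m2)⁻¹
      + (Fintype.card (Tor K) : ℝ)⁻¹ * ∑ q ∈ Finset.univ.erase 0, (lapSym K c m2 q)⁻¹ * (chi K q (x - y)).re := by
  rw [lapF_inv_apply_eq_fourier K hc hm x y, ← Finset.add_sum_erase _ _ (Finset.mem_univ (0 : Tor K)), lapSym_zero_momentum, chi_zero_left, Complex.one_re, mul_one,
    mul_add, mul_inv]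

/-- ★★ **THE REGULAR PART IS BOUNDED UNIFORMLY IN THE MASS**: `|G_T(x,y) − 1∕(|T|m²)| ≤ |T|⁻¹Σ_{q≠0}(lapSym K c 0 q)⁻¹` (`c > 0`, `m² > 0`). [cite: King1986, (2.17) p.653, (4.4) p.670, (4.35) p.674] -/
theorem abs_lapF_inv_sub_zeroMode_le (hc : 0 < c) {m2 : ℝ} (hm : 0 < m2) (x y : Tor K) :
    |(lapF K c m2)⁻¹ x y - ((Fintype.card (Tor K) : ℝ) * m2)⁻¹| ≤ (Fintype.card (Tor K) : ℝ)⁻¹ * ∑ q ∈ Finset.univ.erase 0, (lapSym K c 0 q)⁻¹ := by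
  rw [lapF_inv_eq_zeroMode_add K hc.le hm x y, add_sub_cancel_left, abs_mul, abs_of_nonneg (by positivity : (0 : ℝ) ≤ (Fintype.card (Tor K) : ℝ)⁻¹)]
  refine mul_le_mul_of_nonneg_left ((Finset.abs_sum_le_sum_abs _ _).trans (Finset.sum_le_sum fun q hq => ?_)) (by positivity)
  have hq0 : q ≠ 0 := Finset.ne_of_mem_erase hq
  have hlam : 0 < lapSym K c 0 q := lapSym_massless_pos K hc hq0
  have hσ : lapSym K c 0 q ≤ lapSym K c m2 q := by rw [lapSym_eq_add_mass K c m2 q]; linarith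
  rw [abs_mul, abs_of_pos (inv_pos.mpr (lt_of_lt_of_le hlam hσ))]
  have hσpos : 0 < lapSym K c m2 q := lt_of_lt_of_le hlam hσ
  calc (lapSym K c m2 q)⁻¹ * |(chi K q (x - y)).re| ≤ (lapSym K c m2 q)⁻¹ * 1 :=
        mul_le_mul_of_nonneg_left ((Complex.abs_re_le_norm _).trans (norm_chi_eq_one K q _).le) (inv_pos.mpr hσpos).le
    _ ≤ (lapSym K c 0 q)⁻¹ := by rw [mul_one]; exact inv_anti₀ hlam hσ

/-- ★★★ **THE ZERO MODE CARRIES THE INFRARED DIVERGENCE**: `m²·G_T(x,y) → |T|⁻¹` as `m² → 0⁺` (`c > 0`, every pair of sites). [cite: King1986, (2.17) p.653, (4.4) p.670, (4.35) p.674] -/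
theorem tendsto_mass_mul_lapF_inv_nhdsGT_zero (hc : 0 < c) (x y : Tor K) :
    Tendsto (fun m2 : ℝ => m2 * (lapF K c m2)⁻¹ x y) (𝓝[>] 0) (𝓝 ((Fintype.card (Tor K) : ℝ)⁻¹)) := by
  have hcard : (0 : ℝ) < Fintype.card (Tor K) := by exact_mod_cast Fintype.card_pos
  -- termwise limits: the zero mode tends to `1`, every other mode to `0`
  have hterm : ∀ q : Tor K, Tendsto (fun m : ℝ => m * (m + lapSym K c 0 q)⁻¹ * (chi K q (x - y)).re) (𝓝[>] 0)
      (𝓝 ((if q = 0 then 1 else 0) * (chi K q (x - y)).re)) := by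
    intro q
    refine Tendsto.mul_const _ ?_
    by_cases hq : q = 0
    · rw [if_pos hq, hq, lapSym_massless_zero]
      refine (tendsto_const_nhds (x := (1 : ℝ))).congr' ?_
      filter_upwards [self_mem_nhdsWithin] with m hm
      rw [add_zero, mul_inv_cancel₀ (ne_of_gt hm)]
    · rw [if_neg hq]
      have hlam : 0 < lapSym K c 0 q := lapSym_massless_pos K hc hq
      have hcont : Tendsto (fun m : ℝ => m * (m + lapSym K c 0 q)⁻¹) (𝓝 0) (𝓝 (0 * (0 + lapSym K c 0 q)⁻¹)) :=
        tendsto_id.mul ((tendsto_id.add tendsto_const_nhds).inv₀ (by rw [zero_add]; exact hlam.ne'))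
      rw [zero_mul] at hcont
      exact hcont.mono_left nhdsWithin_le_nhds
  have hsum := (tendsto_finsetSum Finset.univ fun q _ => hterm q).const_mul ((Fintype.card (Tor K) : ℝ)⁻¹)
  have hval : (Fintype.card (Tor K) : ℝ)⁻¹ * ∑ q : Tor K, (if q = 0 then (1 : ℝ) else 0) * (chi K q (x - y)).re = (Fintype.card (Tor K) : ℝ)⁻¹ := by
    rw [Finset.sum_eq_single 0 (fun q _ hq => by rw [if_neg hq, zero_mul]) (fun h => absurd (Finset.mem_univ 0) h), if_pos rfl, chi_zero_left, Complex.one_re, mul_one, mul_one]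
  rw [hval] at hsum
  refine hsum.congr' ?_
  filter_upwards [self_mem_nhdsWithin] with m hm
  have hm' : 0 < m := hm
  conv_rhs => rw [lapF_inv_apply_eq_fourier K hc.le hm' x y, mul_left_comm, Finset.mul_sum]
  congr 1
  refine Finset.sum_congr rfl fun q _ => ?_
  rw [lapSym_eq_add_mass K c m q]
  ring

/-- ★★ **THE ZERO-MODE DECOMPOSITION OF THE DETERMINANT**: `ln det(c(−Δ)+m²) = ln m² + Σ_{q≠0} ln lapSym(q)`. [cite: King1986, (3.89) p.668, (4.4) p.670] -/
theorem log_det_lapF_eq_zeroMode_add (hc : 0 ≤ c) {m2 : ℝ} (hm : 0 < m2) :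
    Real.log (lapF K c m2).det = Real.log m2 + ∑ q ∈ Finset.univ.erase 0, Real.log (lapSym K c m2 q) := by
  rw [log_det_lapF K hc hm, ← Finset.add_sum_erase _ _ (Finset.mem_univ (0 : Tor K)), lapSym_zero_momentum]

/-- ★★ **THE INFRARED LIMIT OF THE DETERMINANT**: `ln det(c(−Δ)+m²) − ln m² → Σ_{q≠0} ln(lapSym K c 0 q)` as `m² → 0⁺` (`c > 0`). [cite: King1986, (3.89) p.668, (4.4) p.670] -/
theorem tendsto_log_det_lapF_sub_log (hc : 0 < c) :
    Tendsto (fun m2 : ℝ => Real.log (lapF K c m2).det - Real.log m2) (𝓝[>] 0) (𝓝 (∑ q ∈ Finset.univ.erase 0, Real.log (lapSym K c 0 q))) := by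
  have hterm : ∀ q ∈ Finset.univ.erase (0 : Tor K), Tendsto (fun m : ℝ => Real.log (m + lapSym K c 0 q)) (𝓝[>] 0) (𝓝 (Real.log (lapSym K c 0 q))) := by
    intro q hq
    have hlam : 0 < lapSym K c 0 q := lapSym_massless_pos K hc (Finset.ne_of_mem_erase hq)
    have h : Tendsto (fun m : ℝ => Real.log (m + lapSym K c 0 q)) (𝓝 0) (𝓝 (Real.log (0 + lapSym K c 0 q))) :=
      (Real.continuousAt_log (by rw [zero_add]; exact hlam.ne')).tendsto.comp (tendsto_id.add tendsto_const_nhds)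
    rw [zero_add] at h
    exact h.mono_left nhdsWithin_le_nhds
  refine (tendsto_finsetSum _ hterm).congr' ?_
  filter_upwards [self_mem_nhdsWithin] with m hm
  have hm' : 0 < m := hm
  rw [log_det_lapF_eq_zeroMode_add K hc.le hm', add_sub_cancel_left]
  exact Finset.sum_congr rfl fun q _ => by rw [lapSym_eq_add_mass K c m q, add_comm]

end Torus

/-! ## §3 The box: the Neumann zero mode -/

section Box

variable (n : Fin (d + 1) → ℕ) [hn : ∀ μ, NeZero (n μ)] {c : ℝ}

/-- the weight of the constant cosine wave is `|Ω|`. [folklore] -/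
theorem boxWaveWeight_zero : boxWaveWeight n 0 = Fintype.card (KingBox n) := by
  rw [card_kingBox n]
  unfold boxWaveWeight
  push_cast
  exact Finset.prod_congr rfl fun μ _ => by simp

/-- ★ the massless box symbol is positive off the zero mode: `k ≠ 0 ⇒ lapSym(2n) c 0 (k̂) > 0` (`c > 0`). [cite: King1986, (4.4) p.670, §4 p.670 l.8–13] -/
theorem lapSym_dblBox_massless_pos (hc : 0 < c) {k : KingBox n} (hk : k ≠ 0) : 0 < lapSym (dblPer n) c 0 (dblBox n k) :=
  lapSym_massless_pos (dblPer n) hc fun h => hk (dblBox_injective n (h.trans (dblBox_zero n).symm))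

/-- ★★ **THE NEUMANN ZERO-MODE DECOMPOSITION**: `G^Ω(s,t) = 1∕(|Ω|m²) + Σ_{k≠0} w_k(s)w_k(t)∕(lapSym(2n)(k̂)·weight_k)` (`c ≥ 0`, `m² > 0`). [cite: King1986, (2.17) p.653, §4 p.670 l.8–13] -/
theorem kingBoxGreen_eq_zeroMode_add (hc : 0 ≤ c) {m2 : ℝ} (hm : 0 < m2) (s t : KingBox n) :
    kingBoxGreen n c m2 s t = ((Fintype.card (KingBox n) : ℝ) * m2)⁻¹
      + ∑ k ∈ Finset.univ.erase 0, boxWave n k s * boxWave n k t / (lapSym (dblPer n) c m2 (dblBox n k) * boxWaveWeight n k) := by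
  rw [kingBoxGreen_eq_sum_boxWave n hc hm s t, ← Finset.add_sum_erase _ _ (Finset.mem_univ (0 : KingBox n)), boxWave_zero, dblBox_zero, lapSym_zero_momentum,
    boxWaveWeight_zero]
  congr 1
  rw [mul_one, one_div, mul_comm]

/-- ★★★ **THE NEUMANN ZERO MODE CARRIES THE INFRARED DIVERGENCE**: `m²·G^Ω(s,t) → |Ω|⁻¹` as `m² → 0⁺` (`c > 0`, every pair of sites). [cite: King1986, (2.17) p.653, §4 p.670 l.8–13] -/
theorem tendsto_mass_mul_kingBoxGreen_nhdsGT_zero (hc : 0 < c) (s t : KingBox n) :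
    Tendsto (fun m2 : ℝ => m2 * kingBoxGreen n c m2 s t) (𝓝[>] 0) (𝓝 ((Fintype.card (KingBox n) : ℝ)⁻¹)) := by
  have hcard : (0 : ℝ) < Fintype.card (KingBox n) := by exact_mod_cast Fintype.card_pos
  have hterm : ∀ k ∈ Finset.univ.erase (0 : KingBox n), Tendsto (fun m : ℝ => m * (boxWave n k s * boxWave n k t / ((m + lapSym (dblPer n) c 0 (dblBox n k)) * boxWaveWeight n k)))
      (𝓝[>] 0) (𝓝 0) := by
    intro k hk
    have hlam : 0 < lapSym (dblPer n) c 0 (dblBox n k) := lapSym_dblBox_massless_pos n hc (Finset.ne_of_mem_erase hk)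
    have hW : 0 < boxWaveWeight n k := boxWaveWeight_pos n k
    have h : Tendsto (fun m : ℝ => m * (boxWave n k s * boxWave n k t / ((m + lapSym (dblPer n) c 0 (dblBox n k)) * boxWaveWeight n k))) (𝓝 0)
        (𝓝 (0 * (boxWave n k s * boxWave n k t / ((0 + lapSym (dblPer n) c 0 (dblBox n k)) * boxWaveWeight n k)))) :=
      tendsto_id.mul (tendsto_const_nhds.div ((tendsto_id.add tendsto_const_nhds).mul tendsto_const_nhds) (by rw [zero_add]; positivity))
    rw [zero_mul] at h
    exact h.mono_left nhdsWithin_le_nhds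
  have hzero : Tendsto (fun m : ℝ => m * ((Fintype.card (KingBox n) : ℝ) * m)⁻¹) (𝓝[>] 0) (𝓝 ((Fintype.card (KingBox n) : ℝ)⁻¹)) := by
    refine (tendsto_const_nhds (x := (Fintype.card (KingBox n) : ℝ)⁻¹)).congr' ?_
    filter_upwards [self_mem_nhdsWithin] with m hm
    rw [mul_inv, mul_left_comm, mul_inv_cancel₀ (ne_of_gt hm), mul_one]
  have hsum := hzero.add (tendsto_finsetSum _ hterm)
  rw [Finset.sum_const_zero, add_zero] at hsum
  refine hsum.congr' ?_
  filter_upwards [self_mem_nhdsWithin] with m hm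
  have hm' : 0 < m := hm
  rw [kingBoxGreen_eq_zeroMode_add n hc.le hm' s t, mul_add, Finset.mul_sum]
  congr 1
  exact Finset.sum_congr rfl fun k _ => by rw [lapSym_eq_add_mass (dblPer n) c m]

/-- ★★ **THE ZERO-MODE DECOMPOSITION OF THE NEUMANN DETERMINANT**: `ln det(c(−Δ_free)+m²)_Ω = ln m² + Σ_{k≠0} ln lapSym(2n)(k̂)`. [cite: King1986, (3.89) p.668, §4 p.670 l.8–13] -/
theorem log_det_boxOp_eq_zeroMode_add (hc : 0 ≤ c) {m2 : ℝ} (hm : 0 < m2) :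
    Real.log (boxOp n c m2).det = Real.log m2 + ∑ k ∈ Finset.univ.erase 0, Real.log (lapSym (dblPer n) c m2 (dblBox n k)) := by
  rw [log_det_boxOp n hc hm, ← Finset.add_sum_erase _ _ (Finset.mem_univ (0 : KingBox n)), dblBox_zero, lapSym_zero_momentum]

/-- ★★ **THE INFRARED LIMIT OF THE NEUMANN DETERMINANT**: `ln det(c(−Δ_free)+m²)_Ω − ln m² → Σ_{k≠0} ln lapSym(2n)(c,0,k̂)` as `m² → 0⁺` (`c > 0`). [cite: King1986, (3.89) p.668, §4 p.670 l.8–13] -/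
theorem tendsto_log_det_boxOp_sub_log (hc : 0 < c) :
    Tendsto (fun m2 : ℝ => Real.log (boxOp n c m2).det - Real.log m2) (𝓝[>] 0) (𝓝 (∑ k ∈ Finset.univ.erase 0, Real.log (lapSym (dblPer n) c 0 (dblBox n k)))) := by
  have hterm : ∀ k ∈ Finset.univ.erase (0 : KingBox n), Tendsto (fun m : ℝ => Real.log (m + lapSym (dblPer n) c 0 (dblBox n k))) (𝓝[>] 0)
      (𝓝 (Real.log (lapSym (dblPer n) c 0 (dblBox n k)))) := by
    intro k hk
    have hlam : 0 < lapSym (dblPer n) c 0 (dblBox n k) := lapSym_dblBox_massless_pos n hc (Finset.ne_of_mem_erase hk)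
    have h : Tendsto (fun m : ℝ => Real.log (m + lapSym (dblPer n) c 0 (dblBox n k))) (𝓝 0) (𝓝 (Real.log (0 + lapSym (dblPer n) c 0 (dblBox n k)))) :=
      (Real.continuousAt_log (by rw [zero_add]; exact hlam.ne')).tendsto.comp (tendsto_id.add tendsto_const_nhds)
    rw [zero_add] at h
    exact h.mono_left nhdsWithin_le_nhds
  refine (tendsto_finsetSum _ hterm).congr' ?_
  filter_upwards [self_mem_nhdsWithin] with m hm
  have hm' : 0 < m := hm
  rw [log_det_boxOp_eq_zeroMode_add n hc.le hm', add_sub_cancel_left]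
  exact Finset.sum_congr rfl fun k _ => by rw [lapSym_eq_add_mass (dblPer n) c m, add_comm]

end Box

end Summit.QuantumFields.YangMills.BalabanUVNodes.N15KingModelRung.TorusSpectral

end
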